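import Literature.AlgebraicGeometry.Morphisms.GeometricallyIrreducibleOfTwoCharts
import Literature.AlgebraicGeometry.Morphisms.IrreducibleOfOpenCoverPairwise
import HarnessLib

/-!
# A scheme covered by a family of geometrically irreducible charts which pairwise meet over every field point is geometrically irreducible

Topic `AlgebraicGeometry/Morphisms`; namespace `Literature.AlgebraicGeometry.Morphisms`. THEOREMS ONLY, no `sorry`.

Family version of ★ `Morphisms/GeometricallyIrreducibleOfTwoCharts.geometricallyIrreducible_of_isOpenImmersion_pair`
([GortzWedhorn2020, Exercise 2.9 with §(4.11)]): let `𝒲 → S` and let `i_a : 𝒱_a → 𝒲` (`a ∈ ι`, `ι` non-empty) be `S`-morphisms which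
are open immersions, jointly surjective, every `𝒱_a → S` GEOMETRICALLY IRREDUCIBLE, and such that for every field point `y : Spec K → S`
and every pair `a, a'` some `K`-point of `𝒲` over `y` lies in the images of both `i_a` and `i_{a'}` (`hmeet`). Then `𝒲 → S` is
geometrically irreducible (`geometricallyIrreducible_of_isOpenImmersion_family`): the base change `𝒲_K` is covered by the open
immersions `𝒱_{a,K} ↪ 𝒲_K` with irreducible sources, whose images pairwise meet (the `K`-point of `hmeet` lifts to `𝒲_K`); conclude by
★ `irreducibleSpace_of_iUnion_of_isOpen`. Intended use: the standard chart covers of Grassmannians / projective spaces over `Spec ℤ`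
(for `S` terminal the condition `x ≫ (𝒲 → S) = y` in `hmeet` is automatic).

## References
* [GortzWedhorn2020] U. Görtz, T. Wedhorn, *Algebraic Geometry I*, 2nd ed. (2020), Exercise 2.9, §(4.11), §(3.5).
* [Artin1986NeronModels] M. Artin, *Néron models* (1986), §2 Lemma 2.4 (the two-chart case).
-/

universe u

open CategoryTheory CategoryTheory.Limits Topology TopologicalSpace

namespace Literature.AlgebraicGeometry.Morphisms

open _root_.AlgebraicGeometry

/-- **A scheme covered by geometrically irreducible charts which pairwise meet over every field point is geometrically irreducible.**
[cite: GortzWedhorn2020, Exercise 2.9 and §(4.11)] [cite: Artin1986NeronModels, §2 Lemma 2.4 (p. 222)] -/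
theorem geometricallyIrreducible_of_isOpenImmersion_family {S : Scheme.{u}} {𝒲 : Over S} {ι : Type*} [Nonempty ι]
    (𝒱 : ι → Over S) (i : ∀ a, 𝒱 a ⟶ 𝒲) [∀ a, IsOpenImmersion (i a).left] [∀ a, GeometricallyIrreducible (𝒱 a).hom]
    (hcover : ⋃ a, Set.range (i a).left.base = Set.univ)
    (hmeet : ∀ (K : Type u) [Field K] (y : Spec (.of K) ⟶ S) (a a' : ι),
      ∃ x : Spec (.of K) ⟶ 𝒲.left, x ≫ 𝒲.hom = y ∧
        ∃ p : Spec (.of K), x.base p ∈ Set.range (i a).left.base ∩ Set.range (i a').left.base) :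
    GeometricallyIrreducible 𝒲.hom := by
  refine ⟨fun K _ y Z fst snd hZ => ?_⟩
  -- the charts `𝒱_{a,K}`, irreducible, and their open immersions `j_a : 𝒱_{a,K} → Z`
  haveI hVK : ∀ a, IrreducibleSpace ↑(pullback (𝒱 a).hom y) := fun a =>
    GeometricallyIrreducible.geometrically_irreducibleSpace _ _ _ (.of_hasPullback (𝒱 a).hom y)
  let j : ∀ a, pullback (𝒱 a).hom y ⟶ Z := fun a =>
    hZ.lift (pullback.fst (𝒱 a).hom y ≫ (i a).left) (pullback.snd (𝒱 a).hom y)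
      (by rw [Category.assoc, Over.w (i a)]; exact pullback.condition)
  have hsq : ∀ a, IsPullback (j a) (pullback.fst (𝒱 a).hom y) fst (i a).left := fun a =>
    isPullback_lift_of_over (i a) y hZ
  haveI : ∀ a, IsOpenImmersion (j a) := fun a =>
    MorphismProperty.of_isPullback (P := @IsOpenImmersion) (hsq a).flip inferInstance
  -- ranges: points of `Z` over `i_a(𝒱_a)` lift to `𝒱_{a,K}`
  have hlift : ∀ (a) (z : Z), fst z ∈ Set.range (i a).left.base → z ∈ Set.range (j a) := by
    rintro a z ⟨v, hv⟩
    obtain ⟨p, -, hp₂⟩ := Scheme.exists_preimage_of_isPullback (hsq a).flip v z (by exact hv)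
    exact ⟨p, hp₂⟩
  -- cover
  have hcov : ⋃ a, Set.range (j a) = Set.univ := by
    refine Set.eq_univ_of_forall fun z => ?_
    have hz : fst z ∈ ⋃ a, Set.range (i a).left.base := by rw [hcover]; trivial
    obtain ⟨a, ha⟩ := Set.mem_iUnion.mp hz
    exact Set.mem_iUnion.mpr ⟨a, hlift a z ha⟩
  -- pairwise meeting: the `K`-point of `hmeet` lifts to `Z`
  have hne : ∀ a a', (Set.range (j a) ∩ Set.range (j a')).Nonempty := fun a a' => by
    obtain ⟨x, hxy, p, ⟨hp₁, hp₂⟩⟩ := hmeet K y a a'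
    let z : Spec (.of K) ⟶ Z := hZ.lift x (𝟙 _) (by rw [hxy, Category.id_comp])
    have hz : fst (z p) = x.base p := by
      change (z ≫ fst) p = x.base p
      rw [hZ.lift_fst]
    exact ⟨z p, hlift a _ (hz ▸ hp₁), hlift a' _ (hz ▸ hp₂)⟩
  -- non-empty: a chart is non-empty
  obtain ⟨a₀⟩ := (inferInstance : Nonempty ι)
  obtain ⟨v₀⟩ := (inferInstance : Nonempty ↑(pullback (𝒱 a₀).hom y))
  haveI : Nonempty Z := ⟨j a₀ v₀⟩
  exact irreducibleSpace_of_iUnion_range (fun a => (j a : _ → Z)) (fun a => (j a).continuous)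
    (fun a => (j a).isOpenEmbedding.isOpen_range) hcov hne

end Literature.AlgebraicGeometry.Morphisms
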